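import Mathlib
import HarnessLib
import Literature.AlgebraicGeometry.Resolution.BlowupsIntegral
import Literature.AlgebraicGeometry.Resolution.BlowupDisjointCentreSplitting
import Summits.ResolutionOfSingularities.ResolutionOfSingularities.Theorems.WildQuotientsWildQuotientResolutionKSGoingDownLocalGlue
import Summits.ResolutionOfSingularities.ResolutionOfSingularities.Theorems.WildQuotientsWildQuotientResolutionKSCentreClosedFixedPoint

/-!
# Kollár–Szabó going down along a REGULAR STABLE CENTRE: the step reproduces its hypotheses
# (crux `WildQuotients.WildQuotientResolution`, stub `stub_phaseZeroHighDim`)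

Crux stmt-ResolutionOfSingularities-15640 (`WildQuotientResolution`), registered stub `stub_phaseZeroHighDim`;
programme PHASE0-KS-EIGENLINE, item (K2-centres) — CLOSING FILE of hand 8-g3's chain (✓`KSCentreEigenline` p830410 →
✓`KSCentreAdaptedGenerators` → ✓`KSCentreChartOrigin` → ✓`KSCentreChartFractions` → ✓`KSCentreMonoidalTransform` →
✓`KSCentreEquivariantChart` → ✓`KSCentreFixedPoint` → ✓`KSCentreFixedPointStalk` → ✓`KSCentreMonoidalTransformFrac/OfPrime/Dim`
→ ✓`KSCentreRegularFixedPoint` → ✓`KSCentreClosedFixedPoint`):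

* ★ `exists_fixedPoint_liftAction_step_of_regularCentre` — integral + locally Noetherian `X'`, and a CLOSED fixed
  point `x'` with full inertia, `𝒪_{X',x'}` regular, `dim 𝒪_{X',x'} = dim 𝒪_{X,x}`, `κ(x')` algebraically closed
  (✓`KSGoingDown.isAlgClosed_residueField_of_residue_surjective`).

So the Kollár–Szabó fixed point climbs ANY tower of blow-ups along regular `G`-stable centres through the successive
fixed points (abelian stabiliser; p-closed twin: swap in ✓`KSCentreRegularFixedPointPClosed`'s glue).

[OURS · crux stmt-ResolutionOfSingularities-15640 · helper toward `stub_phaseZeroHighDim` ((K2-centres) step; NOT a proof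
of the stub); counted 0; AI-level work, weaker than expert review.]
[cite: ReichsteinYoussin2000, Appendix (Kollár–Szabó), proof of Prop. A.2]
-/

-- single-problem summit: the doubled namespace component `ResolutionOfSingularities` is forced
set_option linter.dupNamespace false

noncomputable section

open CategoryTheory CategoryTheory.Limits AlgebraicGeometry TopologicalSpace IsLocalRing
open Literature.AlgebraicGeometry.Ramification Literature.AlgebraicGeometry.Resolution
open Scheme.IdealSheafData
open Summit.ResolutionOfSingularities.ResolutionOfSingularities.Theorems.WildQuotientResolution

namespace Summit.ResolutionOfSingularities.ResolutionOfSingularities.Theorems.WildQuotientResolution.CentreChart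

universe u

/-- **The Kollár–Szabó step along a regular stable centre reproduces all of its hypotheses.** For an integral
locally Noetherian `X`, an ABELIAN `G` with `g ∈ I_x` for all `g` at a CLOSED point `x` with `𝒪_{X,x}` regular and
`κ(x)` algebraically closed, a `σ`-stable ideal sheaf `I ≠ 0` whose stalk `I_x ≠ 0` is generated by part of a regular
system of parameters (a REGULAR centre through `x`), and ANY blowing up `π : X' → X` along `I` with its LIFTED action:
`X'` is integral and locally Noetherian, and there is a CLOSED point `x' ∈ X'` over `x`, in the inertia group of every
`g`, with `𝒪_{X',x'}` REGULAR of the SAME dimension and `κ(x')` ALGEBRAICALLY CLOSED. Blow-ups along regular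
`G`-stable centres at points fixed by an abelian group never lose the fixed point: the positive-dimensional-centre form
of hand 8-g2's ✓`KSGoingDown.exists_fixedPoint_liftAction_step`.
[cite: ReichsteinYoussin2000, Appendix (Kollár–Szabó), proof of Prop. A.2] [cite: Liu2002, Thm. 8.1.19 (a)] -/
theorem exists_fixedPoint_liftAction_step_of_regularCentre {X : Scheme.{0}} [IsIntegral X]
    [IsLocallyNoetherian X] {G : Type} [CommGroup G] (σ : G →* Aut X) {x : X} (hxc : IsClosed ({x} : Set X))
    (hGx : ∀ g, g ∈ inertiaSubgroup σ x)
    [IsRegularLocalRing (X.presheaf.stalk x)] [IsAlgClosed (ResidueField (X.presheaf.stalk x))]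
    {I : X.IdealSheafData} (hI : ∀ g, I.comap (σ g).hom = I)
    {d m : ℕ} (hd : (maximalIdeal (X.presheaf.stalk x)).spanFinrank = d) (xs : Fin d → X.presheaf.stalk x)
    (hxs : Ideal.span (Set.range xs) = maximalIdeal (X.presheaf.stalk x))
    (e : Fin m → Fin d) (he : Function.Injective e)
    (hIx : stalkIdeal I x = Ideal.span (Set.range (xs ∘ e))) (hIx0 : stalkIdeal I x ≠ ⊥) (hI0 : I ≠ ⊥)
    {X' : Scheme.{0}} {π : X' ⟶ X} (hπ : IsBlowup π I) :
    IsIntegral X' ∧ IsLocallyNoetherian X' ∧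
    ∃ x' : X', π x' = x ∧ IsClosed ({x'} : Set X') ∧ (∀ g, g ∈ inertiaSubgroup (hπ.liftAction σ hI) x') ∧
      IsRegularLocalRing (X'.presheaf.stalk x') ∧ IsAlgClosed (ResidueField (X'.presheaf.stalk x')) ∧
      ringKrullDim (X'.presheaf.stalk x') = ringKrullDim (X.presheaf.stalk x) := by
  haveI : IsIntegral X' := hπ.isIntegral hI0
  have hlN : IsLocallyNoetherian X' := hπ.isLocallyNoetherian
  -- the stalk action of `G = I_x`, its residue-triviality and the stability of `I_x`
  obtain ⟨a, τ, hkey, hτ⟩ := PointBlowupStalkData.exists_stalkAction σ x (⊤ : Subgroup G)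
    (fun g _ => apply_eq_of_mem_inertiaSubgroup σ (hGx g))
  have htop : (⊤ : Subgroup G) ≤ inertiaSubgroup σ x := fun g _ => hGx g
  have hresO : ∀ (g : (⊤ : Subgroup G)) (s : X.presheaf.stalk x), τ g s - s ∈ maximalIdeal _ :=
    InertLocusStalk.stalkAction_residueTrivial σ x a τ hkey hτ htop
  have hstabI : ∀ (g : (⊤ : Subgroup G)), ∀ r ∈ stalkIdeal I x, (a g).hom r ∈ stalkIdeal I x :=
    stalkIdeal_stable_of_stalkAction σ ⊤ (fun g _ => apply_eq_of_mem_inertiaSubgroup σ (hGx g)) a hkey hI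
  have hJτ : ∀ g : (⊤ : Subgroup G), ∀ r ∈ Ideal.span (Set.range (xs ∘ e)),
      τ g r ∈ Ideal.span (Set.range (xs ∘ e)) := by
    intro g r hr
    rw [← hIx] at hr ⊢
    rw [hτ]
    exact hstabI g⁻¹ r hr
  have hJ0 : Ideal.span (Set.range (xs ∘ e)) ≠ ⊥ := hIx ▸ hIx0
  -- the equivariant monoidal transform with its localisation datum and dimension bound
  obtain ⟨R, hRloc, ι, hιloc, t, α, hreg, hdimR, hι, hιinj, ht0, hmap, hα, hres, hcong, a₀, ha₀J, ha₀t, hfrac⟩ :=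
    exists_equivariant_monoidalTransform_of_action_dim hd xs hxs e he hJ0 τ hresO hJτ
  -- repackage over `G`
  let a' : G → (X.presheaf.stalk x ⟶ X.presheaf.stalk x) := fun g => a ⟨g, Subgroup.mem_top g⟩
  have hkey' : ∀ g, Spec.map (a' g) ≫ X.fromSpecStalk x = X.fromSpecStalk x ≫ (σ g).hom := fun g =>
    hkey ⟨g, Subgroup.mem_top g⟩
  let α' : G → (R →+* R) := fun g => α ⟨g⁻¹, Subgroup.mem_top _⟩
  have hα' : ∀ g, (α' g).comp ι = ι.comp (a' g).hom := by
    intro g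
    have hinv : (⟨g⁻¹, Subgroup.mem_top _⟩ : (⊤ : Subgroup G))⁻¹ = ⟨g, Subgroup.mem_top g⟩ :=
      Subtype.ext (inv_inv g)
    refine (hα ⟨g⁻¹, Subgroup.mem_top _⟩).trans ?_
    ext s
    change ((ι (τ ⟨g⁻¹, Subgroup.mem_top _⟩ s) : R) : FractionRing (X.presheaf.stalk x)) =
      ((ι ((a ⟨g, Subgroup.mem_top g⟩).hom s) : R) : FractionRing (X.presheaf.stalk x))
    rw [hτ, hinv]
  have hres' : ∀ (g : G) (r : R), α' g r - r ∈ maximalIdeal R := fun g r => hres _ r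
  have htnz : t ∈ nonZeroDivisors R := mem_nonZeroDivisors_of_ne_zero ht0
  have hmapI : (stalkIdeal I x).map ι = Ideal.span {t} := by rw [hIx]; exact hmap
  -- the local chart and its fixed point
  obtain ⟨φ, x', hφ, hφx', hx'x, hinert⟩ :=
    KSGoingDown.exists_fixedPoint_liftAction_of_localChart_of_stalkIdeal hπ σ hI a' hkey' ι htnz hmapI α'
      hα' hres'
  -- the stalk identification `𝒪_{X',x'} ≅ R`
  have ha₀I : a₀ ∈ stalkIdeal I x := by rw [hIx]; exact ha₀J
  have ha₀0 : a₀ ≠ 0 := by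
    rintro rfl
    exact ht0 (by rw [← ha₀t, map_zero])
  have hmapI' : (stalkIdeal I x).map ι = Ideal.span {ι a₀} := by rw [hmapI, ha₀t]
  set B : Subring (FractionRing (X.presheaf.stalk x)) := Subring.closure
      (((algebraMap (X.presheaf.stalk x) (FractionRing (X.presheaf.stalk x))).range : Set _) ∪
        {z | ∃ m ∈ stalkIdeal I x, z = algebraMap _ (FractionRing (X.presheaf.stalk x)) m /
          algebraMap _ (FractionRing (X.presheaf.stalk x)) a₀}) with hB
  have hfracB : ∀ r : R, ∃ a ∈ B, ∃ b ∈ B, b⁻¹ ∈ R ∧ (r : FractionRing (X.presheaf.stalk x)) = a / b := by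
    intro r
    obtain ⟨a, b, ha, hb, hbinv, hrab⟩ := hfrac r
    have hle : Subring.closure (((algebraMap (X.presheaf.stalk x) (FractionRing (X.presheaf.stalk x))).range :
          Set _) ∪ {z | ∃ m ∈ Ideal.span (Set.range (xs ∘ e)),
            z = algebraMap _ (FractionRing (X.presheaf.stalk x)) m /
              algebraMap _ (FractionRing (X.presheaf.stalk x)) a₀}) ≤ B := by
      refine Subring.closure_mono ?_
      rintro z (hz | ⟨m, hm, rfl⟩)
      · exact Or.inl hz
      · exact Or.inr ⟨m, by rw [hIx]; exact hm, rfl⟩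
    exact ⟨a, hle ha, b, hle hb, hbinv, hrab⟩
  haveI := hRloc
  haveI := hιloc
  haveI := hreg
  obtain ⟨eR⟩ := nonempty_stalk_ringEquiv_of_localizedChart hπ R ι hι ha₀I ha₀0 hmapI' B le_rfl hfracB φ hφ hφx'
  have hregx' : IsRegularLocalRing (X'.presheaf.stalk x') := IsRegularLocalRing.of_ringEquiv eR.symm
  -- dimension: `d ≤ dim R = dim 𝒪_{X',x'} ≤ dim 𝒪_{X,x} = d`
  have hdimx : ringKrullDim (X.presheaf.stalk x) = d := by
    rw [← IsRegularLocalRing.spanFinrank_maximalIdeal, hd]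
  have hdimeq : ringKrullDim (X'.presheaf.stalk x') = ringKrullDim (X.presheaf.stalk x) := by
    apply le_antisymm
    · have h := hπ.ringKrullDim_stalk_le x'
      rwa [hx'x] at h
    · rw [ringKrullDim_eq_of_ringEquiv eR, hdimx]
      exact hdimR
  have hclosed : IsClosed ({x'} : Set X') := hπ.isClosed_singleton_axialPoint hx'x hxc hdimeq
  -- the residue field of `x'` is that of `x`, hence algebraically closed
  have hsurj : ∀ z : R, ∃ s : X.presheaf.stalk x, z - ι s ∈ maximalIdeal R := fun z => by
    obtain ⟨a, ha⟩ := hcong z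
    exact ⟨a, by rw [← neg_sub]; exact neg_mem ha⟩
  haveI : IsAlgClosed (ResidueField R) := KSGoingDown.isAlgClosed_residueField_of_residue_surjective ι hsurj
  exact ⟨inferInstance, hlN, x', hx'x, hclosed, hinert, hregx',
    IsAlgClosed.of_ringEquiv (ResidueField R) _ (ResidueField.mapEquiv eR.symm), hdimeq⟩

end Summit.ResolutionOfSingularities.ResolutionOfSingularities.Theorems.WildQuotientResolution.CentreChart

end
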